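import Summits.QuantumFields.YangMills.Theorems.ConvexGribovBodyCovarianceBoundDefs
import Literature.MathematicalPhysics.QuantumFieldTheory.LatticeGaugeProofs

/-!
# Stub `stub_sinLeCos` (crux `CovarianceBound`, stmt-QuantumFields-8780, line `Sketch`)

For a spatial momentum `p ≠ 0` on the torus `(2S+1)⁴`, the Wilson mean of `sup_h ‖Ŝ_j(p)‖²_F`
over the absolute Coulomb minimisers is at most `4` times that of `sup_h ‖Ĉ_j(p)‖²_F` (given
existence of minimisers, the bounds `≤ N L⁶` and measurability, all from `stub_supMeasurable`).

Proof. (1) A spatial translation `τ_a = torusConfigShift (0,a)` intertwines gauge transformations,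
`(τ_aU)^{h(· - (0,a))} = τ_a(U^h)`, so the slice Coulomb functional is invariant and
`h ↦ h(· - (0,a))` maps minimisers of `U` onto minimisers of `τ_aU`. (2) The gauge-fixed gluon
field is translated, so reindexing the mode sums rotates the mid-link modes:
`Ŝ_j(p; τ_aU) = cos α · Ŝ_j(p; U) + sin α · Ĉ_j(p; U)`, `α = 2πp·a/L` (phases agree mod `2π`,
`ZMod.val_add`). (3) Entrywise `|c₁x + c₂y|² ≤ 2c₁²|x|² + 2c₂²|y|²` gives
`sup‖Ŝ‖²(τ_aU) ≤ 2cos²α sup‖Ŝ‖²(U) + 2sin²α sup‖Ĉ‖²(U)`. (4) Translation invariance of the Wilson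
measure (`wilsonMeasure_map_torusConfigShift`) yields `I_s ≤ 2cos²α I_s + 2sin²α I_c`. (5) With
`p_i ≠ 0`, `g = gcd(p_i, L)`, `L' = L/g ≥ 3` odd, Bézout in `ZMod L` (`ZMod.mul_inv_eq_gcd`) gives
`a = t e_i` with `p·a ≡ k g (mod L)`, `k = ⌈L'/6⌉ ∈ [L'/6, L'/3]`, so `cos²α ≤ 1/4` and
`I_s ≤ I_s/2 + 2 I_c`. Reference: D. Zwanziger, Nucl. Phys. B364 (1991) 127; folklore.
-/

set_option autoImplicit false

noncomputable section

namespace Summit.QuantumFields.YangMills.Cruxes.CovarianceBound.SupportWindow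

open scoped BigOperators Matrix
open MeasureTheory Literature.MathematicalPhysics.QuantumFieldTheory

variable {G : Type} [Group G] [TopologicalSpace G]

/-- On `[π/3, 2π/3]` one has `cos² ≤ 1/4`. [folklore] -/
private theorem cos_sq_le_quarter {x : ℝ} (h1 : Real.pi / 3 ≤ x) (h2 : x ≤ 2 * Real.pi / 3) :
    Real.cos x ^ 2 ≤ 1 / 4 := by
  have hle : Real.cos x ≤ 1 / 2 := Real.cos_pi_div_three ▸
    Real.cos_le_cos_of_nonneg_of_le_pi (by positivity) (by linarith [Real.pi_pos]) h1
  have h23 : Real.cos (2 * Real.pi / 3) = -(1 / 2) := by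
    rw [show 2 * Real.pi / 3 = Real.pi - Real.pi / 3 by ring, Real.cos_pi_sub,
      Real.cos_pi_div_three]
  have hge : -(1 / 2) ≤ Real.cos x := h23 ▸ Real.cos_le_cos_of_nonneg_of_le_pi
    (by linarith [Real.pi_pos]) (by linarith [Real.pi_pos]) h2
  nlinarith [hle, hge]

/-- If `M ≡ n (mod L)` with `n/L ∈ [1/6, 1/3]` then `cos²(2πM/L) ≤ 1/4`. [folklore] -/
private theorem cos_sq_le_quarter_of_mod {L M n : ℕ} (hL : 0 < L) (hmod : M % L = n)
    (h6 : L ≤ 6 * n) (h3 : 3 * n ≤ L) :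
    Real.cos (2 * Real.pi * (M : ℝ) / L) ^ 2 ≤ 1 / 4 := by
  have hM : (M : ℝ) = n + L * ((M / L : ℕ) : ℝ) := by
    have h := Nat.mod_add_div M L
    rw [hmod] at h
    exact_mod_cast h.symm
  have hLr : (0 : ℝ) < L := by exact_mod_cast hL
  have hsplit : 2 * Real.pi * (M : ℝ) / L =
      2 * Real.pi * n / L + ((M / L : ℕ) : ℝ) * (2 * Real.pi) := by
    rw [hM]
    field_simp
  rw [hsplit, Real.cos_add_nat_mul_two_pi]
  have h6r : (L : ℝ) ≤ 6 * n := by exact_mod_cast h6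
  have h3r : 3 * (n : ℝ) ≤ L := by exact_mod_cast h3
  apply cos_sq_le_quarter
  · rw [le_div_iff₀ hLr]
    nlinarith [Real.pi_pos]
  · rw [div_le_iff₀ hLr]
    nlinarith [Real.pi_pos]

/-- For odd `L` and `q ≠ 0` in `ZMod L` some `t` has `cos²(2π · q.val · t.val / L) ≤ 1/4`: the
multiples of `q` are those of `g = gcd(q, L)` (Bézout, `ZMod.mul_inv_eq_gcd`), `L' = L/g ≥ 3` is
odd, and `k = ⌈L'/6⌉` satisfies `L' ≤ 6k`, `3k ≤ L'`. [folklore] -/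
private theorem exists_cos_sq_le_quarter {L : ℕ} [NeZero L] (hL : Odd L) (q : ZMod L)
    (hq : q ≠ 0) :
    ∃ t : ZMod L, Real.cos (2 * Real.pi * (((q.val * t.val : ℕ) : ℝ)) / L) ^ 2 ≤ 1 / 4 := by
  have hm0 : 0 < q.val := ZMod.val_pos.mpr hq
  have hmL : q.val < L := ZMod.val_lt q
  have hgm : Nat.gcd q.val L ≤ q.val := Nat.gcd_le_left L hm0
  have hg0 : 0 < Nat.gcd q.val L := Nat.gcd_pos_of_pos_left L hm0
  obtain ⟨L', hL'⟩ := Nat.gcd_dvd_right q.val L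
  set g : ℕ := Nat.gcd q.val L with hg
  have hL'odd : Odd L' := by
    have h : Odd (g * L') := hL' ▸ hL
    exact Nat.Odd.of_mul_right h
  have hL'ge : 3 ≤ L' := by
    have h1 : g * 1 < g * L' := by rw [mul_one, ← hL']; omega
    have h2 : 1 < L' := Nat.lt_of_mul_lt_mul_left h1
    obtain ⟨c, hc⟩ := hL'odd
    omega
  set k : ℕ := (L' + 5) / 6 with hk
  have hk6 : L' ≤ 6 * k := by omega
  have hk3 : 3 * k ≤ L' := by obtain ⟨c, hc⟩ := hL'odd; omega
  have hkL' : k < L' := by omega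
  have hkgL : k * g < L := by
    calc k * g = g * k := mul_comm _ _
      _ < g * L' := Nat.mul_lt_mul_of_pos_left hkL' hg0
      _ = L := hL'.symm
  have h6 : L ≤ 6 * (k * g) := by
    calc L = g * L' := hL'
      _ ≤ g * (6 * k) := Nat.mul_le_mul_left g hk6
      _ = 6 * (k * g) := by ring
  have h3 : 3 * (k * g) ≤ L := by
    calc 3 * (k * g) = g * (3 * k) := by ring
      _ ≤ g * L' := Nat.mul_le_mul_left g hk3
      _ = L := hL'.symm
  refine ⟨(k : ZMod L) * q⁻¹, ?_⟩
  have hcast : ((q.val * ((k : ZMod L) * q⁻¹).val : ℕ) : ZMod L) = ((k * g : ℕ) : ZMod L) := by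
    push_cast
    rw [ZMod.natCast_zmod_val, ZMod.natCast_zmod_val, mul_left_comm, ZMod.mul_inv_eq_gcd]
  have hmod : (q.val * ((k : ZMod L) * q⁻¹).val) % L = k * g := by
    rw [(ZMod.natCast_eq_natCast_iff' _ _ _).mp hcast, Nat.mod_eq_of_lt hkgL]
  exact cos_sq_le_quarter_of_mod (Nat.pos_of_ne_zero (NeZero.ne L)) hmod h6 h3

section Translation

variable [MeasurableSpace G]

/-- `(x + e_i) - v = (x - v) + e_i` on the torus. [folklore] -/
private theorem shift_sub {d L : ℕ} (x v : Site d L) (i : Fin d) :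
    x.shift i - v = (x - v).shift i := by
  simp only [Site.shift, add_sub_right_comm]

omit [TopologicalSpace G] in
/-- A translation intertwines the gauge transformation by `h` with that by the translated `h`:
`(τ_v U)^{h(· - v)}_e = (U^h)_{e - v}`. [folklore] -/
private theorem gaugeTransform_shift {d L : ℕ} (v : Site d L) (h : Site d L → G)
    (U : GaugeConfig d L G) (e : Edge d L) :
    gaugeTransform (fun x => h (x - v)) (torusConfigShift v U) e =
      gaugeTransform h U (e.1 - v, e.2) := by
  simp only [gaugeTransform, torusConfigShift_apply, shift_sub]

/-- The slice Coulomb functional is invariant under spatial translations (`v 0 = 0`). [folklore] -/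
private theorem coulombF_shift (r : LatticeRep G) (S : ℕ) (v : Site 4 (2 * S + 1))
    (hv : v 0 = 0) (U : GaugeConfig 4 (2 * S + 1) G) (h : Site 4 (2 * S + 1) → G) :
    coulombF r S (torusConfigShift v U) (fun x => h (x - v)) = coulombF r S U h := by
  unfold coulombF
  simp only [gaugeTransform_shift]
  congr 1
  refine Fintype.sum_equiv ((Equiv.subRight v).prodCongr (Equiv.refl (Fin 4))) _ _ fun e => ?_
  rcases e with ⟨x, i⟩
  simp [hv]

/-- Translating a minimiser of the translated configuration back gives a minimiser. [folklore] -/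
private theorem isCoulMin_of_shift (r : LatticeRep G) (S : ℕ) (v : Site 4 (2 * S + 1))
    (hv : v 0 = 0) (U : GaugeConfig 4 (2 * S + 1) G) (h : Site 4 (2 * S + 1) → G)
    (hmin : IsCoulMin r S (torusConfigShift v U) (fun x => h (x - v))) : IsCoulMin r S U h := by
  intro h'
  have key := hmin (fun x => h' (x - v))
  rwa [coulombF_shift r S v hv, coulombF_shift r S v hv] at key

/-- `(0, y) - (0, a) = (0, y - a)`. [folklore] -/
private theorem cons_zero_sub (S : ℕ) (y a : Fin 3 → ZMod (2 * S + 1)) :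
    (Fin.cons (0 : ZMod (2 * S + 1)) y : Site 4 (2 * S + 1)) - Fin.cons 0 a =
      Fin.cons 0 (y - a) := by
  funext i
  refine Fin.cases ?_ (fun i => ?_) i <;> simp

/-- The gauge-fixed gluon field of the translated pair is the translated gluon field:
`A_j(y; τ_aU, h(· - a)) = A_j(y - a; U, h)`. [folklore] -/
private theorem gluon_shift (r : LatticeRep G) (S : ℕ) (a : Fin 3 → ZMod (2 * S + 1))
    (U : GaugeConfig 4 (2 * S + 1) G) (h : Site 4 (2 * S + 1) → G)
    (y : Fin 3 → ZMod (2 * S + 1)) (j : Fin 3) :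
    gluon r S (torusConfigShift (Fin.cons 0 a) U) (fun x => h (x - Fin.cons 0 a)) y j =
      gluon r S U h (y - a) j := by
  unfold gluon
  rw [gaugeTransform_shift]
  simp only [cons_zero_sub]

end Translation

/-- The mid-link phases `θ_y = 2π(p·y + p_j/2)/L` are additive modulo `2π` under translations:
`θ_y + 2πp·a/L ≡ θ_{y+a}` (`ZMod.val_add`). [folklore] -/
private theorem phase_add (S : ℕ) (p a : Fin 3 → ZMod (2 * S + 1)) (j : Fin 3)
    (y : Fin 3 → ZMod (2 * S + 1)) : ∃ n : ℕ,
    2 * Real.pi * ((∑ i : Fin 3, ((p i).val : ℝ) * ((y i).val : ℝ)) + ((p j).val : ℝ) / 2) /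
          (2 * S + 1) +
        2 * Real.pi * (∑ i : Fin 3, ((p i).val : ℝ) * ((a i).val : ℝ)) / (2 * S + 1) =
      2 * Real.pi * ((∑ i : Fin 3, ((p i).val : ℝ) * (((y + a) i).val : ℝ)) +
          ((p j).val : ℝ) / 2) / (2 * S + 1) + n * (2 * Real.pi) := by
  refine ⟨∑ i : Fin 3, (p i).val * (((y i).val + (a i).val) / (2 * S + 1)), ?_⟩
  have key : ∀ i : Fin 3, ((y i).val : ℝ) + ((a i).val : ℝ) =
      (((y + a) i).val : ℝ) +
        (2 * S + 1 : ℝ) * ((((y i).val + (a i).val) / (2 * S + 1) : ℕ) : ℝ) := by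
    intro i
    have h1 : ((y + a) i).val = ((y i).val + (a i).val) % (2 * S + 1) := by
      rw [Pi.add_apply, ZMod.val_add]
    have h2 := Nat.mod_add_div ((y i).val + (a i).val) (2 * S + 1)
    rw [← h1] at h2
    exact_mod_cast h2.symm
  have hsum : (∑ i : Fin 3, ((p i).val : ℝ) * ((y i).val : ℝ)) +
      ∑ i : Fin 3, ((p i).val : ℝ) * ((a i).val : ℝ) =
      (∑ i : Fin 3, ((p i).val : ℝ) * (((y + a) i).val : ℝ)) + (2 * S + 1 : ℝ) *
        ((∑ i : Fin 3, (p i).val * (((y i).val + (a i).val) / (2 * S + 1)) : ℕ) : ℝ) := by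
    push_cast
    rw [Finset.mul_sum, ← Finset.sum_add_distrib, ← Finset.sum_add_distrib]
    refine Finset.sum_congr rfl fun i _ => ?_
    rw [← mul_add, key i]
    ring
  have hL : (2 * S + 1 : ℝ) ≠ 0 := by positivity
  field_simp
  linear_combination 2 * hsum

/-- Reindexing `y ↦ y - a` rotates the pair of (sin, cos)-weighted sums by `α` when the phases
satisfy `θ_y + α ≡ θ_{y+a} (mod 2π)` (addition formula for `sin`). [folklore] -/
private theorem sum_sin_smul_shift {S N : ℕ} (θ : (Fin 3 → ZMod (2 * S + 1)) → ℝ) (α : ℝ)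
    (g : (Fin 3 → ZMod (2 * S + 1)) → Fin 3 → Matrix (Fin N) (Fin N) ℂ)
    (a : Fin 3 → ZMod (2 * S + 1)) (j : Fin 3)
    (hθ : ∀ y, ∃ n : ℕ, θ y + α = θ (y + a) + n * (2 * Real.pi)) :
    ∑ y, ((Real.sin (θ y) : ℝ) : ℂ) • g (y - a) j =
      ((Real.cos α : ℝ) : ℂ) • ∑ y, ((Real.sin (θ y) : ℝ) : ℂ) • g y j +
        ((Real.sin α : ℝ) : ℂ) • ∑ y, ((Real.cos (θ y) : ℝ) : ℂ) • g y j := by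
  have hre : ∑ y, ((Real.sin (θ y) : ℝ) : ℂ) • g (y - a) j =
      ∑ y, ((Real.sin (θ (y + a)) : ℝ) : ℂ) • g y j :=
    Fintype.sum_equiv (Equiv.subRight a) _ _ fun y => by
      simp only [Equiv.subRight_apply, sub_add_cancel]
  have hrot : ∀ y, Real.sin (θ (y + a)) =
      Real.cos α * Real.sin (θ y) + Real.sin α * Real.cos (θ y) := by
    intro y
    obtain ⟨n, hn⟩ := hθ y
    rw [show θ (y + a) = θ y + α - n * (2 * Real.pi) by linarith, Real.sin_sub_nat_mul_two_pi,
      Real.sin_add]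
    ring
  rw [hre]
  simp only [hrot, Complex.ofReal_add, Complex.ofReal_mul, add_smul, mul_smul,
    Finset.sum_add_distrib, Finset.smul_sum]

/-- For `p ≠ 0` there are a spatial translation `a` and an angle `α` (`= 2πp·a/L`) with
`cos² α ≤ 1/4` such that `Ŝ_j(p; τ_aU, h(· - a)) = cos α · Ŝ_j(p; U, h) + sin α · Ĉ_j(p; U, h)`
for all `U`, `h`. [folklore] -/
private theorem exists_rotation [MeasurableSpace G] (r : LatticeRep G) (S : ℕ)
    (p : Fin 3 → ZMod (2 * S + 1)) (j : Fin 3) (hp : p ≠ 0) :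
    ∃ (a : Fin 3 → ZMod (2 * S + 1)) (α : ℝ), Real.cos α ^ 2 ≤ 1 / 4 ∧
      ∀ (U : GaugeConfig 4 (2 * S + 1) G) (h : Site 4 (2 * S + 1) → G),
        sinMode r S p j (torusConfigShift (Fin.cons 0 a) U) (fun x => h (x - Fin.cons 0 a)) =
          ((Real.cos α : ℝ) : ℂ) • sinMode r S p j U h +
            ((Real.sin α : ℝ) : ℂ) • cosMode r S p j U h := by
  obtain ⟨i₀, hi₀⟩ : ∃ i, p i ≠ 0 := Function.ne_iff.mp hp
  obtain ⟨t, ht⟩ := exists_cos_sq_le_quarter (L := 2 * S + 1) ⟨S, rfl⟩ (p i₀) hi₀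
  obtain ⟨a, ha⟩ : ∃ a : Fin 3 → ZMod (2 * S + 1), a = Pi.single i₀ t := ⟨_, rfl⟩
  refine ⟨a, 2 * Real.pi * (∑ i : Fin 3, ((p i).val : ℝ) * ((a i).val : ℝ)) / (2 * S + 1), ?_,
    fun U h => ?_⟩
  · have hangle : 2 * Real.pi * (∑ i : Fin 3, ((p i).val : ℝ) * ((a i).val : ℝ)) / (2 * S + 1) =
        2 * Real.pi * ((((p i₀).val * t.val : ℕ) : ℝ)) / ((2 * S + 1 : ℕ) : ℝ) := by
      push_cast
      congr 2
      rw [Finset.sum_eq_single i₀]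
      · simp [ha]
      · intro i _ hi
        simp [ha, Pi.single_eq_of_ne hi]
      · intro h
        exact absurd (Finset.mem_univ _) h
    rw [hangle]
    exact ht
  · unfold sinMode cosMode
    simp only [gluon_shift]
    exact sum_sin_smul_shift _ _ (gluon r S U h) a j (phase_add S p a j)

omit [Group G] [TopologicalSpace G] in
/-- `froSq ≥ 0`. [folklore] -/
private theorem froSq_nonneg' {N : ℕ} (M : Matrix (Fin N) (Fin N) ℂ) : 0 ≤ froSq M :=
  Finset.sum_nonneg fun _ _ => Finset.sum_nonneg fun _ _ => by positivity

omit [Group G] [TopologicalSpace G] in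
/-- `‖c₁A + c₂B‖²_F ≤ 2c₁²‖A‖²_F + 2c₂²‖B‖²_F` for real scalars. [folklore] -/
private theorem froSq_add_le {N : ℕ} (c₁ c₂ : ℝ) (A B : Matrix (Fin N) (Fin N) ℂ) :
    froSq (((c₁ : ℝ) : ℂ) • A + ((c₂ : ℝ) : ℂ) • B) ≤
      2 * c₁ ^ 2 * froSq A + 2 * c₂ ^ 2 * froSq B := by
  unfold froSq
  rw [Finset.mul_sum, Finset.mul_sum, ← Finset.sum_add_distrib]
  refine Finset.sum_le_sum fun a _ => ?_
  rw [Finset.mul_sum, Finset.mul_sum, ← Finset.sum_add_distrib]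
  refine Finset.sum_le_sum fun b _ => ?_
  simp only [Matrix.add_apply, Matrix.smul_apply, smul_eq_mul]
  have h1 := norm_add_le ((c₁ : ℂ) * A a b) ((c₂ : ℂ) * B a b)
  rw [norm_mul, norm_mul, Complex.norm_real, Complex.norm_real] at h1
  have h2 : ‖(c₁ : ℂ) * A a b + (c₂ : ℂ) * B a b‖ ^ 2 ≤ (‖c₁‖ * ‖A a b‖ + ‖c₂‖ * ‖B a b‖) ^ 2 :=
    pow_le_pow_left₀ (norm_nonneg _) h1 2
  have h3 : (‖c₁‖ * ‖A a b‖ + ‖c₂‖ * ‖B a b‖) ^ 2 ≤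
      2 * (‖c₁‖ * ‖A a b‖) ^ 2 + 2 * (‖c₂‖ * ‖B a b‖) ^ 2 := by
    nlinarith [sq_nonneg (‖c₁‖ * ‖A a b‖ - ‖c₂‖ * ‖B a b‖)]
  calc _ ≤ _ := h2
    _ ≤ _ := h3
    _ = 2 * c₁ ^ 2 * ‖A a b‖ ^ 2 + 2 * c₂ ^ 2 * ‖B a b‖ ^ 2 := by
      rw [mul_pow, mul_pow, Real.norm_eq_abs, Real.norm_eq_abs, sq_abs, sq_abs]; ring

/-- `sup‖Ŝ‖²(τ_aU) ≤ 2cos²α · sup‖Ŝ‖²(U) + 2sin²α · sup‖Ĉ‖²(U)`: translation maps minimisers to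
minimisers and rotates the modes. [folklore] -/
private theorem supSinSq_shift_le [MeasurableSpace G] (r : LatticeRep G) (S : ℕ)
    (p a : Fin 3 → ZMod (2 * S + 1)) (j : Fin 3) (α : ℝ)
    (hrot : ∀ (U : GaugeConfig 4 (2 * S + 1) G) (h : Site 4 (2 * S + 1) → G),
      sinMode r S p j (torusConfigShift (Fin.cons 0 a) U) (fun x => h (x - Fin.cons 0 a)) =
        ((Real.cos α : ℝ) : ℂ) • sinMode r S p j U h + ((Real.sin α : ℝ) : ℂ) • cosMode r S p j U h)
    (hex : ∀ U : GaugeConfig 4 (2 * S + 1) G, ∃ h, IsCoulMin r S U h)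
    (hbd : ∀ (U : GaugeConfig 4 (2 * S + 1) G) (h : Site 4 (2 * S + 1) → G),
      froSq (cosMode r S p j U h) ≤ r.N * (2 * S + 1 : ℝ) ^ 6 ∧
      froSq (sinMode r S p j U h) ≤ r.N * (2 * S + 1 : ℝ) ^ 6)
    (U : GaugeConfig 4 (2 * S + 1) G) :
    supSinSq r S p j (torusConfigShift (Fin.cons 0 a) U) ≤
      2 * Real.cos α ^ 2 * supSinSq r S p j U + 2 * Real.sin α ^ 2 * supCosSq r S p j U := by
  have hv0 : (Fin.cons 0 a : Site 4 (2 * S + 1)) 0 = 0 := by simp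
  obtain ⟨h₀, hh₀⟩ := hex (torusConfigShift (Fin.cons 0 a) U)
  haveI : Nonempty {h // IsCoulMin r S (torusConfigShift (Fin.cons 0 a) U) h} := ⟨⟨h₀, hh₀⟩⟩
  have hbddS : BddAbove (Set.range fun h : {h // IsCoulMin r S U h} =>
      froSq (sinMode r S p j U h.1)) :=
    ⟨_, by rintro _ ⟨h, rfl⟩; exact (hbd U h.1).2⟩
  have hbddC : BddAbove (Set.range fun h : {h // IsCoulMin r S U h} =>
      froSq (cosMode r S p j U h.1)) :=
    ⟨_, by rintro _ ⟨h, rfl⟩; exact (hbd U h.1).1⟩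
  unfold supSinSq
  refine ciSup_le fun h' => ?_
  -- translate the minimiser `h'` of `τ_aU` back to a minimiser `h` of `U`
  set h : Site 4 (2 * S + 1) → G := fun x => h'.1 (x + Fin.cons 0 a) with hh
  have hh' : (fun x => h (x - Fin.cons 0 a)) = h'.1 := by funext x; simp [hh, sub_add_cancel]
  have hmin : IsCoulMin r S U h :=
    isCoulMin_of_shift r S (Fin.cons 0 a) hv0 U h (hh' ▸ h'.2)
  rw [← hh', hrot U h]
  refine (froSq_add_le _ _ _ _).trans ?_
  have h1 : froSq (sinMode r S p j U h) ≤
      ⨆ h : {h // IsCoulMin r S U h}, froSq (sinMode r S p j U h.1) :=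
    le_ciSup hbddS ⟨h, hmin⟩
  have h2 : froSq (cosMode r S p j U h) ≤ supCosSq r S p j U :=
    le_ciSup hbddC ⟨h, hmin⟩
  have hc : 0 ≤ 2 * Real.cos α ^ 2 := by positivity
  have hs : 0 ≤ 2 * Real.sin α ^ 2 := by positivity
  exact add_le_add (mul_le_mul_of_nonneg_left h1 hc) (mul_le_mul_of_nonneg_left h2 hs)

/-- **Stub 3 — `∫ sup‖Ŝ_j‖² ≤ 4 ∫ sup‖Ĉ_j‖²` for `p ≠ 0`.** A spatial translation `τ_a` maps
minimisers to minimisers and rotates `(Ĉ_j, Ŝ_j)` by `θ = 2πp·a/L`, so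
`sup‖Ŝ‖²(τ_aU) ≤ 2cos²θ sup‖Ŝ‖²(U) + 2sin²θ sup‖Ĉ‖²(U)`; integrate using
`wilsonMeasure_map_torusConfigShift` and choose `a` with `|cos θ| ≤ 1/2` (the values `p·a mod L`
form a subgroup of odd order `L' ≥ 3` of `ZMod L`). [folklore] -/
theorem stub_sinLeCos :
    ∀ (G : Type) [Group G] [TopologicalSpace G] [IsTopologicalGroup G] [CompactSpace G]
    [MeasurableSpace G] [BorelSpace G] (r : LatticeRep G) (β : ℝ) (S : ℕ)
    (p : Fin 3 → ZMod (2 * S + 1)) (j : Fin 3), p ≠ 0 →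
    (∀ U : GaugeConfig 4 (2 * S + 1) G, ∃ h, IsCoulMin r S U h) →
    (∀ (U : GaugeConfig 4 (2 * S + 1) G) (h : Site 4 (2 * S + 1) → G),
      froSq (cosMode r S p j U h) ≤ r.N * (2 * S + 1 : ℝ) ^ 6 ∧
      froSq (sinMode r S p j U h) ≤ r.N * (2 * S + 1 : ℝ) ^ 6) →
    Measurable (supCosSq r S p j) → Measurable (supSinSq r S p j) →
    ∫ U, supSinSq r S p j U ∂(wilson4 r β S) ≤
      4 * ∫ U, supCosSq r S p j U ∂(wilson4 r β S) := by
  intro G _ _ _ _ _ _ r β S p j hp hex hbd hmc hms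
  -- Step 5: a translation `a` and an angle `α` with `cos² α ≤ 1/4` rotating `Ŝ_j` into `Ĉ_j`
  obtain ⟨a, α, hcos, hrot⟩ := exists_rotation r S p j hp
  have hsin : Real.sin α ^ 2 ≤ 1 := Real.sin_sq_le_one _
  -- the translation and the invariance of the Wilson measure
  set μ : Measure (GaugeConfig 4 (2 * S + 1) G) := wilson4 r β S with hμ
  set τ : GaugeConfig 4 (2 * S + 1) G ≃ᵐ GaugeConfig 4 (2 * S + 1) G :=
    torusConfigShift (Fin.cons 0 a) with hτ
  have hmap : μ.map τ = μ := by
    simp only [hμ, hτ, wilson4]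
    exact wilsonMeasure_map_torusConfigShift _ _ _
  -- pointwise bound
  have hpt : ∀ U, supSinSq r S p j (τ U) ≤
      (1 / 2) * supSinSq r S p j U + 2 * supCosSq r S p j U := by
    intro U
    refine (supSinSq_shift_le r S p a j α hrot hex hbd U).trans ?_
    have hS0 : 0 ≤ supSinSq r S p j U := Real.iSup_nonneg fun _ => froSq_nonneg' _
    have hC0 : 0 ≤ supCosSq r S p j U := Real.iSup_nonneg fun _ => froSq_nonneg' _
    nlinarith
  -- integrability (bounded measurable functions on a probability space)
  have hSbd : ∀ U, ‖supSinSq r S p j U‖ ≤ r.N * (2 * S + 1 : ℝ) ^ 6 := by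
    intro U
    rw [Real.norm_of_nonneg (show 0 ≤ supSinSq r S p j U from
      Real.iSup_nonneg fun _ => froSq_nonneg' _)]
    exact Real.iSup_le (fun h => (hbd U h.1).2) (by positivity)
  have hCbd : ∀ U, ‖supCosSq r S p j U‖ ≤ r.N * (2 * S + 1 : ℝ) ^ 6 := by
    intro U
    rw [Real.norm_of_nonneg (show 0 ≤ supCosSq r S p j U from
      Real.iSup_nonneg fun _ => froSq_nonneg' _)]
    exact Real.iSup_le (fun h => (hbd U h.1).1) (by positivity)
  have hintS : Integrable (supSinSq r S p j) μ :=
    Integrable.of_bound hms.aestronglyMeasurable _ (ae_of_all _ hSbd)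
  have hintC : Integrable (supCosSq r S p j) μ :=
    Integrable.of_bound hmc.aestronglyMeasurable _ (ae_of_all _ hCbd)
  have hintSτ : Integrable (fun U => supSinSq r S p j (τ U)) μ :=
    Integrable.of_bound (hms.comp τ.measurable).aestronglyMeasurable _
      (ae_of_all _ fun U => hSbd (τ U))
  -- Step 6: `I_s = ∫ supSinSq ∘ τ ≤ I_s / 2 + 2 I_c`
  have heq : ∫ U, supSinSq r S p j U ∂μ = ∫ U, supSinSq r S p j (τ U) ∂μ := by
    rw [← integral_map_equiv τ (supSinSq r S p j), hmap]
  have hle : ∫ U, supSinSq r S p j (τ U) ∂μ ≤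
      ∫ U, ((1 / 2) * supSinSq r S p j U + 2 * supCosSq r S p j U) ∂μ :=
    integral_mono hintSτ ((hintS.const_mul _).add (hintC.const_mul _)) hpt
  rw [integral_add (hintS.const_mul _) (hintC.const_mul _), integral_const_mul,
    integral_const_mul] at hle
  linarith

end Summit.QuantumFields.YangMills.Cruxes.CovarianceBound.SupportWindow

end
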